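import Literature.NumberTheory.Sieve.LinearEquationsInPrimesGowersCyclic
import Mathlib.Analysis.Fourier.ZMod
import Mathlib.Analysis.MeanInequalities
import HarnessLib

/-!
# The `U²(ℤ_M)` norm and the discrete Fourier transform (the inverse theorem for `U²`)

Trunk T-SIEVE (`Literature/NumberTheory/Sieve`). Part of the decomposition of
`Literature.NumberTheory.Sieve.GreenTaoZiegler2012_finiteComplexity`, layer "Thm. 7.2" at level
`s = 1` (`Literature.NumberTheory.Sieve.GreenTao2010_gowersUniformityAt 1`): the classical
Fourier description of the `U²` Gowers norm on `ℤ_M` ("The case `s = 1` [of `GI(s)`] is an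
exercise in harmonic analysis", Green–Tao 2010, §8), for real functions and the cube form
`Literature.NumberTheory.Sieve.gowersPower 2` of `LinearEquationsInPrimesGowersCyclic.lean`.
Everything is proved:

* `dftCoeff f ξ = (1/M) ∑_x f(x) e(-xξ/M)` — the Fourier coefficient, with Mathlib's standard
  additive character `ZMod.stdAddChar` (`e(j/M)`); orthogonality (`sum_stdAddChar_mul_eq`),
  Parseval (`sum_norm_dftCoeff_sq`), linearity and the trivial bound;
* `gowersPower_two_eq_sum_norm_dftCoeff_pow_four` — **`‖f‖_{U²}^4 = ∑_ξ |f̂(ξ)|⁴`** (via the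
  autocorrelation `Γ`, `Literature.NumberTheory.Sieve.gowersPower_two_eq`: `‖f‖_{U²}^4 = 𝔼 Γ²`,
  `Γ̂ = |f̂|²`, Parseval);
* consequences: `|f̂(ξ)|⁴ ≤ ‖f‖_{U²}^4` (`norm_dftCoeff_pow_four_le`), the inverse theorem for bounded
  functions `‖g‖_{U²}^4 ≤ (sup_ξ |ĝ(ξ)|)² 𝔼 g²` (`gowersPower_two_le_of_dft`), the triangle
  inequality for `‖·‖_{U²}` (`gowersPower_two_quarter_add_le`, Minkowski in `ℓ⁴`), and the
  assembled **`U²`-inverse step relative to a decomposition** `F = g + h`, `|g| ≤ 1`: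
  `‖F‖_{U²} ≤ (sup_ξ |F̂(ξ)| + ‖h‖_{U²})^{1/2} + ‖h‖_{U²}` (`gowersPower_two_quarter_le_of_decomp`) —
  the form in which Green–Tao 2010, §10 ("Proof of Proposition 10.1": apply `GI(s)` to the bounded
  part `f₁` and "nilsequences obstruct uniformity" to `f₂`) is used at `s = 1`, where both `GI(1)`
  and the obstruction statement are the identity `‖f‖_{U²} = ‖f̂‖_{ℓ⁴}`.

## References

* B. Green, T. Tao, *Linear equations in primes*, Ann. of Math. 171 (2010), §8 (the case `s = 1`
  of `GI(s)`), §10 (proof of Prop. 10.1), App. B. [cite: GreenTao2010, §8 and §10]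
* T. Tao, V. Vu, *Additive Combinatorics*, CUP 2006, (11.5)–(11.6): `‖f‖_{U²} = ‖f̂‖_4`. [folklore]
-/

noncomputable section

open Finset ZMod
open scoped BigOperators ComplexConjugate

namespace Literature.NumberTheory.Sieve

section fourier

variable {M : ℕ} [NeZero M]

/-- The Fourier coefficient `f̂(ξ) = (1/M) ∑_{x ∈ ℤ_M} f(x) e(-xξ/M)` of a real function on `ℤ_M`
(`e(j/M) = ZMod.stdAddChar j`). [folklore] -/
def dftCoeff (f : ZMod M → ℝ) (ξ : ZMod M) : ℂ :=
  (∑ x : ZMod M, (f x : ℂ) * stdAddChar (-(x * ξ))) / M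

/-- Orthogonality of the additive characters of `ℤ_M`: `∑_i e(ti/M) = M [t = 0]`. [folklore] -/
theorem sum_stdAddChar_mul_eq (t : ZMod M) :
    ∑ i : ZMod M, stdAddChar (t * i) = if t = 0 then (M : ℂ) else 0 := by
  split_ifs with h
  · simp only [h, zero_mul, AddChar.map_zero_eq_one, sum_const, card_univ, ZMod.card,
      nsmul_eq_mul, mul_one]
  · exact AddChar.sum_eq_zero_of_ne_one (isPrimitive_stdAddChar M h)

/-- `conj e(a/M) = e(-a/M)`. [folklore] -/
theorem conj_stdAddChar (a : ZMod M) : conj (stdAddChar a : ℂ) = stdAddChar (-a) := by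
  rw [stdAddChar_apply, stdAddChar_apply, AddChar.map_neg_eq_inv, Circle.coe_inv_eq_conj]

/-- `|e(a/M)| = 1`. [folklore] -/
theorem norm_stdAddChar (a : ZMod M) : ‖(stdAddChar a : ℂ)‖ = 1 := by
  rw [stdAddChar_apply, Circle.norm_coe]

/-- Linearity of `f ↦ f̂`. [folklore] -/
theorem dftCoeff_add (f g : ZMod M → ℝ) (ξ : ZMod M) :
    dftCoeff (fun x => f x + g x) ξ = dftCoeff f ξ + dftCoeff g ξ := by
  unfold dftCoeff
  rw [← add_div, ← sum_add_distrib]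
  congr 1
  refine sum_congr rfl fun x _ => ?_
  push_cast
  ring

/-- The trivial bound `|f̂(ξ)| ≤ (1/M) ∑ |f|`. [folklore] -/
theorem norm_dftCoeff_le (f : ZMod M → ℝ) (ξ : ZMod M) :
    ‖dftCoeff f ξ‖ ≤ (∑ x : ZMod M, |f x|) / M := by
  have hM : (0 : ℝ) < M := by exact_mod_cast Nat.pos_of_ne_zero (NeZero.ne M)
  unfold dftCoeff
  rw [norm_div, Complex.norm_natCast]
  refine div_le_div_of_nonneg_right ((norm_sum_le _ _).trans (le_of_eq ?_)) hM.le
  refine sum_congr rfl fun x _ => ?_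
  rw [norm_mul, norm_stdAddChar, mul_one, Complex.norm_real, Real.norm_eq_abs]

/-- `f̂(ξ) · conj f̂(ξ)` as a double sum. [folklore] -/
theorem dftCoeff_mul_conj (f : ZMod M → ℝ) (ξ : ZMod M) :
    dftCoeff f ξ * conj (dftCoeff f ξ) =
      (∑ x : ZMod M, ∑ y : ZMod M, (f x : ℂ) * f y * stdAddChar ((y - x) * ξ)) / ((M : ℂ) * M) := by
  unfold dftCoeff
  rw [map_div₀, map_natCast, map_sum, div_mul_div_comm, sum_mul_sum]
  congr 1
  refine sum_congr rfl fun x _ => sum_congr rfl fun y _ => ?_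
  rw [map_mul, Complex.conj_ofReal, conj_stdAddChar, neg_neg, mul_mul_mul_comm, ← AddChar.map_add_eq_mul]
  congr 2
  ring

/-- **Parseval**: `∑_ξ |f̂(ξ)|² = (1/M) ∑_x f(x)²`. [folklore] -/
theorem sum_norm_dftCoeff_sq (f : ZMod M → ℝ) :
    ∑ ξ : ZMod M, ‖dftCoeff f ξ‖ ^ 2 = (∑ x : ZMod M, f x ^ 2) / M := by
  have hM : (M : ℂ) ≠ 0 := by exact_mod_cast NeZero.ne M
  have key : (∑ ξ : ZMod M, dftCoeff f ξ * conj (dftCoeff f ξ)) = (((∑ x : ZMod M, f x ^ 2) / M : ℝ) : ℂ) := by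
    simp_rw [dftCoeff_mul_conj]
    rw [← sum_div, sum_comm]
    -- `∑_ξ ∑_x ∑_y f x f y e((y-x)ξ) = ∑_x ∑_y f x f y · M[y = x]`
    have h1 : ∑ x : ZMod M, ∑ ξ : ZMod M, ∑ y : ZMod M, (f x : ℂ) * f y * stdAddChar ((y - x) * ξ) =
        ∑ x : ZMod M, (f x : ℂ) * f x * M := by
      refine sum_congr rfl fun x _ => ?_
      rw [sum_comm]
      simp_rw [← mul_sum, sum_stdAddChar_mul_eq, sub_eq_zero, mul_ite, mul_zero]
      rw [Finset.sum_ite_eq' univ x, if_pos (mem_univ _)]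
    rw [h1]
    push_cast
    rw [div_eq_div_iff (mul_ne_zero hM hM) hM, Finset.sum_mul, Finset.sum_mul]
    exact sum_congr rfl fun x _ => by ring
  have h2 : ∀ ξ : ZMod M, dftCoeff f ξ * conj (dftCoeff f ξ) = ((‖dftCoeff f ξ‖ ^ 2 : ℝ) : ℂ) := fun ξ => by
    rw [Complex.mul_conj, Complex.normSq_eq_norm_sq]
  simp_rw [h2] at key
  exact_mod_cast key

/-- The Fourier transform of the autocorrelation is `|f̂|²`:
`(1/M) ∑_t Γ(t) e(-tξ/M) = f̂(ξ) conj f̂(ξ)`, `Γ(t) = 𝔼_y f(y) f(y + t)`. [folklore] -/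
theorem dftCoeff_autocorr (f : ZMod M → ℝ) (ξ : ZMod M) :
    dftCoeff (autocorr f) ξ = dftCoeff f ξ * conj (dftCoeff f ξ) := by
  rw [dftCoeff_mul_conj]
  unfold dftCoeff
  have h1 : ∀ t : ZMod M, ((autocorr f t : ℝ) : ℂ) = (∑ y : ZMod M, (f y : ℂ) * f (y + t)) / M := by
    intro t
    unfold autocorr
    rw [Fintype.expect_eq_sum_div_card, ZMod.card]
    push_cast
    rfl
  simp_rw [h1]
  have h2 : ∑ t : ZMod M, (∑ y : ZMod M, (f y : ℂ) * f (y + t)) / M * stdAddChar (-(t * ξ)) =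
      (∑ t : ZMod M, (∑ y : ZMod M, (f y : ℂ) * f (y + t)) * stdAddChar (-(t * ξ))) / M := by
    rw [Finset.sum_div]
    exact sum_congr rfl fun t _ => by ring
  rw [h2, div_div]
  congr 1
  -- `∑_t ∑_y f(y) f(y+t) e(-tξ) = ∑_x ∑_y f(x) f(y) e((y-x)ξ)`
  simp_rw [Finset.sum_mul]
  rw [sum_comm]
  have h3 : ∀ y : ZMod M, ∑ t : ZMod M, (f y : ℂ) * f (y + t) * stdAddChar (-(t * ξ)) =
      ∑ z : ZMod M, (f y : ℂ) * f z * stdAddChar ((y - z) * ξ) := by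
    intro y
    rw [← Equiv.sum_comp (Equiv.addLeft y) fun z => (f y : ℂ) * f z * stdAddChar ((y - z) * ξ)]
    refine sum_congr rfl fun t _ => ?_
    simp only [Equiv.coe_addLeft]
    congr 2
    ring
  simp_rw [h3]
  rw [sum_comm]
  refine sum_congr rfl fun x _ => sum_congr rfl fun y _ => ?_
  ring

/-- **`‖f‖_{U²(ℤ_M)}^4 = ∑_ξ |f̂(ξ)|⁴`.** [cite: GreenTao2010, §8 (the case `s = 1`)] -/
theorem gowersPower_two_eq_sum_norm_dftCoeff_pow_four (f : ZMod M → ℝ) :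
    gowersPower 2 f = ∑ ξ : ZMod M, ‖dftCoeff f ξ‖ ^ 4 := by
  rw [gowersPower_two_eq, Fintype.expect_eq_sum_div_card, ZMod.card, ← sum_norm_dftCoeff_sq]
  refine sum_congr rfl fun ξ _ => ?_
  rw [dftCoeff_autocorr, Complex.mul_conj, Complex.normSq_eq_norm_sq]
  norm_cast
  rw [Real.norm_eq_abs, abs_pow, abs_norm]
  ring

/-- Each Fourier coefficient is controlled by the `U²` norm: `|f̂(ξ)|⁴ ≤ ‖f‖_{U²}^4`.
[cite: GreenTao2010, §8] -/
theorem norm_dftCoeff_pow_four_le (f : ZMod M → ℝ) (ξ : ZMod M) :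
    ‖dftCoeff f ξ‖ ^ 4 ≤ gowersPower 2 f := by
  rw [gowersPower_two_eq_sum_norm_dftCoeff_pow_four]
  exact single_le_sum (f := fun ξ => ‖dftCoeff f ξ‖ ^ 4) (fun ξ _ => by positivity) (mem_univ ξ)

/-- **The inverse theorem for `U²`, bounded functions**: `‖g‖_{U²}^4 ≤ (sup_ξ |ĝ(ξ)|)² · (1/M)∑ g²`.
[cite: GreenTao2010, §8 ("The case `s = 1` is an exercise in harmonic analysis")] -/
theorem gowersPower_two_le_of_dft (g : ZMod M → ℝ) {δ : ℝ}
    (hδ : ∀ ξ, ‖dftCoeff g ξ‖ ≤ δ) :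
    gowersPower 2 g ≤ δ ^ 2 * ((∑ x : ZMod M, g x ^ 2) / M) := by
  rw [gowersPower_two_eq_sum_norm_dftCoeff_pow_four, ← sum_norm_dftCoeff_sq, mul_sum]
  refine sum_le_sum fun ξ _ => ?_
  rw [show ‖dftCoeff g ξ‖ ^ 4 = ‖dftCoeff g ξ‖ ^ 2 * ‖dftCoeff g ξ‖ ^ 2 by ring]
  exact mul_le_mul_of_nonneg_right (pow_le_pow_left₀ (norm_nonneg _) (hδ ξ) 2) (by positivity)

/-- The triangle inequality for `‖·‖_{U²(ℤ_M)}` (Minkowski in `ℓ⁴` for the Fourier coefficients).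
[folklore] -/
theorem gowersPower_two_quarter_add_le (g h : ZMod M → ℝ) :
    gowersPower 2 (fun x => g x + h x) ^ (1 / 4 : ℝ) ≤
      gowersPower 2 g ^ (1 / 4 : ℝ) + gowersPower 2 h ^ (1 / 4 : ℝ) := by
  have h4 : ∀ F : ZMod M → ℝ, gowersPower 2 F = ∑ ξ : ZMod M, |‖dftCoeff F ξ‖| ^ (4 : ℝ) := by
    intro F
    rw [gowersPower_two_eq_sum_norm_dftCoeff_pow_four]
    refine sum_congr rfl fun ξ _ => ?_
    rw [abs_norm, show (4 : ℝ) = ((4 : ℕ) : ℝ) by norm_num, Real.rpow_natCast]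
  have hmink := Real.Lp_add_le (univ : Finset (ZMod M)) (fun ξ => ‖dftCoeff g ξ‖)
    (fun ξ => ‖dftCoeff h ξ‖) (p := 4) (by norm_num)
  rw [h4 g, h4 h, h4]
  refine le_trans ?_ hmink
  refine Real.rpow_le_rpow (sum_nonneg fun ξ _ => by positivity) (sum_le_sum fun ξ _ => ?_)
    (by norm_num)
  rw [abs_norm, dftCoeff_add]
  refine Real.rpow_le_rpow (norm_nonneg _) ((norm_add_le _ _).trans (le_of_eq ?_)) (by norm_num)
  rw [abs_of_nonneg (by positivity)]

/-- **The `U²`-inverse step relative to a decomposition** (the case `s = 1` of the argument of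
Green–Tao 2010, §10, proof of Prop. 10.1): if `F = g + h` with `|g| ≤ 1`, `sup_ξ |F̂(ξ)| ≤ δ` and
`‖h‖_{U²}^4 ≤ τ⁴`, then `‖F‖_{U²} ≤ (δ + τ)^{1/2} + τ`. (Indeed `|ĝ| ≤ |F̂| + |ĥ| ≤ δ + τ` since
`|ĥ(ξ)| ≤ ‖h‖_{U²}`, so `‖g‖_{U²}^4 ≤ (δ + τ)²` by the inverse theorem for bounded functions, and
the triangle inequality concludes.) [cite: GreenTao2010, §10 (proof of Prop. 10.1) and §8] -/
theorem gowersPower_two_quarter_le_of_decomp {F g h : ZMod M → ℝ} (hF : ∀ x, F x = g x + h x)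
    (hg : ∀ x, |g x| ≤ 1) {δ τ : ℝ} (hδ0 : 0 ≤ δ) (hτ0 : 0 ≤ τ)
    (hδ : ∀ ξ, ‖dftCoeff F ξ‖ ≤ δ) (hτ : gowersPower 2 h ≤ τ ^ 4) :
    gowersPower 2 F ^ (1 / 4 : ℝ) ≤ Real.sqrt (δ + τ) + τ := by
  have hM : (0 : ℝ) < M := by exact_mod_cast Nat.pos_of_ne_zero (NeZero.ne M)
  -- `‖h‖_{U²} ≤ τ` and `|ĥ(ξ)| ≤ τ`
  have hhq : gowersPower 2 h ^ (1 / 4 : ℝ) ≤ τ := by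
    calc gowersPower 2 h ^ (1 / 4 : ℝ) ≤ (τ ^ 4) ^ (1 / 4 : ℝ) :=
          Real.rpow_le_rpow (gowersPower_nonneg (by norm_num) h) hτ (by norm_num)
      _ = τ := by
          rw [show (1 / 4 : ℝ) = ((4 : ℕ) : ℝ)⁻¹ by norm_num]
          exact Real.pow_rpow_inv_natCast hτ0 (by norm_num)
  have hhξ : ∀ ξ, ‖dftCoeff h ξ‖ ≤ τ := fun ξ =>
    le_of_pow_le_pow_left₀ (by norm_num) hτ0 ((norm_dftCoeff_pow_four_le h ξ).trans hτ)
  -- `|ĝ(ξ)| ≤ δ + τ`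
  have hgξ : ∀ ξ, ‖dftCoeff g ξ‖ ≤ δ + τ := by
    intro ξ
    have heq : dftCoeff g ξ = dftCoeff F ξ - dftCoeff h ξ := by
      rw [eq_sub_iff_add_eq, ← dftCoeff_add]
      congr 1
      funext x
      exact (hF x).symm
    rw [heq]
    exact (norm_sub_le _ _).trans (add_le_add (hδ ξ) (hhξ ξ))
  -- `‖g‖_{U²}^4 ≤ (δ + τ)²`
  have hg2 : (∑ x : ZMod M, g x ^ 2) / M ≤ 1 := by
    rw [div_le_one hM]
    calc ∑ x : ZMod M, g x ^ 2 ≤ ∑ _x : ZMod M, (1 : ℝ) := sum_le_sum fun x _ => by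
          exact (sq_le_one_iff_abs_le_one _).mpr (hg x)
      _ = M := by rw [sum_const, card_univ, ZMod.card, nsmul_eq_mul, mul_one]
  have hgU : gowersPower 2 g ≤ (δ + τ) ^ 2 := by
    refine (gowersPower_two_le_of_dft g hgξ).trans ?_
    calc (δ + τ) ^ 2 * ((∑ x : ZMod M, g x ^ 2) / M) ≤ (δ + τ) ^ 2 * 1 :=
          mul_le_mul_of_nonneg_left hg2 (by positivity)
      _ = (δ + τ) ^ 2 := mul_one _
  have hgq : gowersPower 2 g ^ (1 / 4 : ℝ) ≤ Real.sqrt (δ + τ) := by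
    calc gowersPower 2 g ^ (1 / 4 : ℝ) ≤ ((δ + τ) ^ 2) ^ (1 / 4 : ℝ) :=
          Real.rpow_le_rpow (gowersPower_nonneg (by norm_num) g) hgU (by norm_num)
      _ = Real.sqrt (δ + τ) := by
          rw [Real.sqrt_eq_rpow, ← Real.rpow_natCast, ← Real.rpow_mul (by positivity)]
          norm_num
  -- triangle inequality
  have hFgh : gowersPower 2 F = gowersPower 2 (fun x => g x + h x) := by
    congr 1
    funext x
    exact hF x
  rw [hFgh]
  exact (gowersPower_two_quarter_add_le g h).trans (add_le_add hgq hhq)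

end fourier

end Literature.NumberTheory.Sieve
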